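import Mathlib
import Summits.Langlands.Langlands.Theses.CapacityClassicality
import Summits.Langlands.Langlands.Theorems.CapacityClassicalityCongruenceToClassicalDefs
import Summits.Langlands.Langlands.Theorems.CapacityClassicalityCongruenceToClassicalCuspBound
import Summits.Langlands.Langlands.Theorems.CapacityClassicalityCongruenceToClassicalHeckeIdentity
import Summits.Langlands.Langlands.Theorems.CapacityClassicalityCongruenceToClassicalQuotient
import Summits.Langlands.Langlands.Theorems.CapacityClassicalityIntegralOverconvergentIsCongruence

/-!
# Line `Sketch` — skeleton v5 for crux `stmt-Langlands-8927`
(`Summit.Langlands.Langlands.Theses.CapacityClassicality.EigenIntegralOverconvergentIsClassical`, β′)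

Continuation lead `prover-line-stmt-Langlands-8927-c2-0` (cycle 3, 2026-08-16).

## What changed at v5 (and why)

Skeleton v4 (leads `…-8927-0`, `…-8927-c1-0`) had landed all of its plumbing (8 helper files,
p103926 … p110781) and was left with two "cores", `EigensystemClassical` (Fontaine–Mazur-type:
an `O_E`-integral overconvergent exact tame eigensystem is classical) and `TowerCoordinatesFinite`
(no overconvergent ghost `V`-tower), which are JOINTLY EQUIVALENT to β′ modulo the landed plumbing
and are open problems of arithmetic — the line had no provable content left.

Meanwhile, in the SAME route, two theorems landed in the tree that settle β′'s logical status: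

* `Summit.Langlands.Langlands.Theorems.congruenceToClassical_proof : CongruenceToClassical`
  (= `IntegralOverconvergentIsCongruence → EigenIntegralOverconvergentIsClassical`, α → β′; item
  stmt-Langlands-10367, CLOSED `proved`, p103635; Mathlib only — cusp-pole removal for a `T_ℓ`-eigen
  quotient `F / Δ^m`).  INLINED below (section `InlinedCongruenceToClassical`, verbatim proof under
  private names) only because the hub has not built that module's olean yet
  (`remote:…:unbuilt:…CongruenceToClassical`); its four imports are built and imported here.  Swap
  back to `import Summits.Langlands.Langlands.Theorems.CapacityClassicalityCongruenceToClassical`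
  when the olean exists (the landed closing file of this crux does import it).
* `Summit.Langlands.Langlands.Theorems.CapacityClassicality.integralOverconvergentIsCongruence_of_sturm_of_unboundedDenominators :
    Sturm1987_congruenceBound_Gamma1_modPrime → CalegariDimitrovTang2025_unboundedDenominators_algInt →
    IntegralOverconvergentIsCongruence` (α conditionally on two PUBLISHED theorems vendored as
  Literature named facts; item stmt-Langlands-8457, p110988, line `Sketch` of that crux).

Hence β′ holds conditionally on exactly the same two named facts, by composition.  Skeleton v5
records this: its only stubs are the two named facts (true published theorems, not yet proved in
Lean — the crux is CLOSED MODULO them), and `EigenIntegralOverconvergentIsClassical_of` concludes the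
crux BY NAME.  The v4 cores are retired (history in `Lines/Sketch.md`); nothing provable remains.

## Stubs (v5)
* `stub_sturm` : `Literature.NumberTheory.ModularForms.Sturm1987_congruenceBound_Gamma1_modPrime`
  — Sturm 1987, Thm 1 (mod `p`, `Γ₁(N)`, `p ∤ N`, cusp forms, integer coefficients). Named fact.
* `stub_unboundedDenominators` :
  `Literature.NumberTheory.Automorphic.CalegariDimitrovTang2025_unboundedDenominators_algInt`
  — Calegari–Dimitrov–Tang, JAMS 38 (2025), Thm 1 + Remarks 58/59 (algebraic-integer
  coefficients, holomorphic case). Named fact.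
-/

set_option linter.dupNamespace false -- `Summit.Langlands.Langlands` is the mandated namespace

/-! ### Inlined copy of the LANDED tree file `…Theorems/CapacityClassicalityCongruenceToClassical.lean`
(p103635; temporary — hub olean not built yet; decls renamed into the `Sketch` namespace as private) -/

section InlinedCongruenceToClassical

noncomputable section

open Complex Filter UpperHalfPlane Function ModularForm SlashInvariantFormClass ModularFormClass
  Matrix.SpecialLinearGroup CongruenceSubgroup

open scoped Real Topology MatrixGroups ModularForm Manifold

open Function.Periodic (qParam)

namespace Summit.Langlands.Langlands.Cruxes.EigenIntegralOverconvergentIsClassical.Sketch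

open Summit.Langlands.Langlands.Theorems.CapacityClassicality

/-- `1` is a strict period of `Γ₁(M)`. -/
private lemma one_mem_strictPeriods_Gamma1_inl (M : ℕ) :
    (1 : ℝ) ∈ (Gamma1 M : Subgroup (GL (Fin 2) ℝ)).strictPeriods := by
  simp

/-- **The modular form `F / Δ ^ m`.** If `F ∈ M_{k'}(Γ₁(M))` has `qExpansion 1 F = g · Δ^m` with
`g = ∑ g n qⁿ` of radius `≥ 1` whose coefficients satisfy the `T_ℓ`-eigenvalue relation for a
prime `ℓ` with `ψℓ ≠ 0`, then `F / Δ ^ m` is a modular form of weight `k = k' - 12 m` on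
`Γ₁(M)`, with `q`-expansion `g`. -/
private theorem exists_modularForm_div_inl {M : ℕ} [NeZero M] {k' : ℤ} (F : ModularForm (Gamma1 M) k')
    (m : ℕ) (k : ℤ) (hk : k = k' - m * 12) {g : ℕ → ℂ}
    (hrad : ∀ t : ℝ, 0 < t → t < 1 → ∃ C : ℝ, ∀ n, ‖g n‖ * t ^ n ≤ C)
    (hF : qExpansion 1 F = PowerSeries.mk g * (qExpansion 1 ModularForm.discriminant) ^ m)
    {ℓ : ℕ} (hℓ : ℓ.Prime) {ψℓ : ℂ} (hψ : ψℓ ≠ 0)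
    (hrel : ∀ n : ℕ, 0 < n →
      g (ℓ * n) + (if ℓ ∣ n then ψℓ * (ℓ : ℂ) ^ (k - 1) * g (n / ℓ) else 0) = g ℓ * g n) :
    ∃ G : ModularForm (Gamma1 M) k, (∀ τ : ℍ, G τ = F τ / ModularForm.discriminant τ ^ m) ∧
      qExpansion 1 G = PowerSeries.mk g := by
  haveI : NeZero ℓ := ⟨hℓ.ne_zero⟩
  have hM : 0 < M := Nat.pos_of_ne_zero (NeZero.ne M)
  -- the `q`-series of `F / Δ ^ m`
  have hG : ∀ τ : ℍ, HasSum (fun n ↦ g n * qParam 1 τ ^ n) (F τ / ModularForm.discriminant τ ^ m) := by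
    intro τ
    have hq : ‖qParam (1 : ℝ) (τ : ℂ)‖ < 1 := Periodic.norm_qParam_lt_one one_pos τ.im_pos
    have hs := (summable_norm_mul_pow_of_bound hrad hq).of_norm.hasSum
    rw [eq_tsum_mul_discriminant_pow (one_mem_strictPeriods_Gamma1_inl M) F m hrad hF τ,
      mul_div_cancel_right₀ _ (pow_ne_zero _ (ModularForm.discriminant_ne_zero τ))]
    exact hs
  -- boundedness at every cusp: cusp-pole removal
  have hbdd : ∀ γ : SL(2, ℤ),
      IsBoundedAtImInfty ((fun τ ↦ F τ / ModularForm.discriminant τ ^ m) ∣[k] γ) := by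
    refine isBoundedAtImInfty_slash_of_hecke (G := fun τ ↦ F τ / ModularForm.discriminant τ ^ m)
      (M := M) (m := m) (ℓ := ℓ) hM hℓ hψ (fun γ' ↦ ?_) (hecke_relation_of_coeff hG hrel)
    obtain ⟨b, hb⟩ := exists_hasSum_slash F γ'
    exact ⟨b, fun τ ↦ by rw [slash_div_discriminant_pow_mul F m k hk γ' τ]; exact hb τ⟩
  let G : ModularForm (Gamma1 M) k :=
    { toFun := fun τ ↦ F τ / ModularForm.discriminant τ ^ m
      slash_action_eq' := fun A hA ↦ by
        obtain ⟨γ, hγ, rfl⟩ := hA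
        exact slash_div_discriminant_pow_of_mem F m k hk hγ
      holo' := mdifferentiable_div_discriminant_pow F m
      bdd_at_cusps' := fun {c} hc ↦ by
        rw [Subgroup.IsArithmetic.isCusp_iff_isCusp_SL2Z] at hc
        rw [OnePoint.isBoundedAt_iff_forall_SL2Z hc]
        intro γ _
        exact hbdd γ }
  have hGτ : ∀ τ : ℍ, G τ = F τ / ModularForm.discriminant τ ^ m := fun τ ↦ rfl
  refine ⟨G, hGτ, ?_⟩
  have hG' : ∀ τ : ℍ, HasSum (fun n ↦ g n • qParam 1 τ ^ n) (G τ) := fun τ ↦ by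
    simpa [hGτ, smul_eq_mul] using hG τ
  ext n
  rw [PowerSeries.coeff_mk]
  exact (ModularFormClass.qExpansion_coeff_unique one_pos (one_mem_strictPeriods_Gamma1_inl M)
    hG' n).symm

/-- Inlined copy of `Summit.Langlands.Langlands.Theorems.congruenceToClassical_proof` (α → β′). -/
private theorem congruenceToClassical_inl :
    Summit.Langlands.Langlands.Theses.CapacityClassicality.CongruenceToClassical := by
  unfold Summit.Langlands.Langlands.Theses.CapacityClassicality.CongruenceToClassical
    Summit.Langlands.Langlands.Theses.CapacityClassicality.EigenIntegralOverconvergentIsClassical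
  intro hα p _ hp N _ hpN k ι E _ _ σ₀ a ψ _ hint hrad hkatz hhecke
  obtain ⟨M, hM, m, F, hF⟩ := hα p hp N hpN k ι E σ₀ a hint hrad hkatz
  -- a prime `ℓ > N p`, hence `ℓ ∤ N p` and `ψ ℓ ≠ 0`
  obtain ⟨ℓ, hℓNp, hℓ⟩ := Nat.exists_infinite_primes (N * p + 1)
  have hp0 : 0 < p := lt_of_lt_of_le (by norm_num) hp
  have hN0 : 0 < N := Nat.pos_of_ne_zero (NeZero.ne N)
  have hndvd : ¬ ℓ ∣ N * p := fun h ↦ by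
    have := Nat.le_of_dvd (Nat.mul_pos hN0 hp0) h
    omega
  have hℓN : ¬ ℓ ∣ N := fun h ↦ hndvd (dvd_mul_of_dvd_left h p)
  have hψ : ψ ℓ ≠ 0 := by
    have hu : IsUnit ((ℓ : ℕ) : ZMod N) := by
      rw [ZMod.isUnit_iff_coprime]
      exact (Nat.Prime.coprime_iff_not_dvd hℓ).mpr hℓN
    exact (hu.map ψ).ne_zero
  -- the coefficient relation in the required shape
  have hrel : ∀ n : ℕ, 0 < n → σ₀ (a (ℓ * n)) +
      (if ℓ ∣ n then ψ ℓ * (ℓ : ℂ) ^ (k - 1) * σ₀ (a (n / ℓ)) else 0) = σ₀ (a ℓ) * σ₀ (a n) :=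
    fun n hn ↦ hhecke ℓ n hℓ hndvd hn
  have hradσ : ∀ t : ℝ, 0 < t → t < 1 → ∃ C : ℝ, ∀ n, ‖σ₀ (a n)‖ * t ^ n ≤ C := hrad σ₀
  have hF' : qExpansion 1 F = PowerSeries.mk (fun n ↦ σ₀ (a n)) *
      (qExpansion 1 ModularForm.discriminant) ^ m := by
    simpa using hF
  have hk : k = (k + 12 * (m : ℤ)) - m * 12 := by ring
  obtain ⟨G, -, hG⟩ := exists_modularForm_div_inl F m k hk hradσ hF' hℓ hψ hrel
  exact ⟨M, hM, G, hG⟩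

end Summit.Langlands.Langlands.Cruxes.EigenIntegralOverconvergentIsClassical.Sketch

end

end InlinedCongruenceToClassical

namespace Summit.Langlands.Langlands.Cruxes.EigenIntegralOverconvergentIsClassical.Sketch

/-- **Stub 1 (named fact): Sturm's congruence bound mod `p` for `Γ₁(N)`.**
J. Sturm, *On the congruence of modular forms*, LNM 1240 (1987), Theorem 1, in the weakened special
case vendored as `Literature.NumberTheory.ModularForms.Sturm1987_congruenceBound_Gamma1_modPrime`
(cusp forms on `Γ₁(N)` with integer `q`-coefficients, `p ∤ N`, bound `k·[SL₂(ℤ):Γ₁(N)]/12`).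
A published theorem; not proved in Lean (needs `q`-expansions at all cusps / the valence formula,
absent from Mathlib). -/
theorem stub_sturm : Literature.NumberTheory.ModularForms.Sturm1987_congruenceBound_Gamma1_modPrime := by
  sorry

/-- **Stub 2 (named fact): the unbounded denominators theorem, algebraic-integer coefficients.**
F. Calegari, V. Dimitrov, Y. Tang, *The unbounded denominators conjecture*, JAMS 38 (2025),
Theorem 1 with Remarks 58/59 (arXiv:2109.09040), holomorphic-at-the-cusps case, vendored as
`Literature.NumberTheory.Automorphic.CalegariDimitrovTang2025_unboundedDenominators_algInt`.
A published theorem; not proved in Lean (research-level arithmetic holonomy bounds). -/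
theorem stub_unboundedDenominators :
    Literature.NumberTheory.Automorphic.CalegariDimitrovTang2025_unboundedDenominators_algInt := by
  sorry

/-! ## Composition (skeleton v5) -/

/-- The line, skeleton v5: β′ follows from α (`IntegralOverconvergentIsCongruence`) by the landed
glue `congruenceToClassical_proof` (cusp-pole removal for the `T_ℓ`-eigen quotient `F / Δ^m`,
item stmt-Langlands-10367; inlined here as `congruenceToClassical_inl`), and α follows from Sturm's
congruence bound and the unbounded denominators theorem by the landed conditional assembly
`integralOverconvergentIsCongruence_of_sturm_of_unboundedDenominators` (Katz–Sturm `𝔭`-adic gain,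
auxiliary polynomial over `𝓞_E`, monodromy, finite-index modularity, CDT endgame; item
stmt-Langlands-8457).  Concludes the crux `EigenIntegralOverconvergentIsClassical` by name, modulo the
two named facts `stub_sturm`, `stub_unboundedDenominators`. -/
theorem EigenIntegralOverconvergentIsClassical_of :
    Summit.Langlands.Langlands.Theses.CapacityClassicality.EigenIntegralOverconvergentIsClassical := by
  have hαβ := congruenceToClassical_inl
  unfold Summit.Langlands.Langlands.Theses.CapacityClassicality.CongruenceToClassical at hαβ
  exact hαβ
    (Summit.Langlands.Langlands.Theorems.CapacityClassicality.integralOverconvergentIsCongruence_of_sturm_of_unboundedDenominators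
      stub_sturm stub_unboundedDenominators)

end Summit.Langlands.Langlands.Cruxes.EigenIntegralOverconvergentIsClassical.Sketch
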